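import Summits.BirchSwinnertonDyer.Rank1Residual.ManinAdditive.PlusIndexLaws
import Summits.BirchSwinnertonDyer.Rank1Residual.ManinAdditive.TwistOrbitDegreeIdentity
import Summits.BirchSwinnertonDyer.BirchSwinnertonDyer.Theorems.ManinLocalTwoThreeWieferichLevel

/-!
# Route `ManinLocalTwoThree` — E-an-136: the SINGLE-PRIME `q`-TOWER REDUCTION of E-es-66 / E-es-66₂
# (cell bsd-f2-manin, analytic lens MEMO-an §71.4, typed HOME/an/g29/Sketch-an-g29.lean f73c501472290adc;
# helper for crux C3 `ManinPrimeToThreeAtNine` stmt-BirchSwinnertonDyer-22968 — input `h66` of the C3 line's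
# `…_of_cuspLifting h66 h128` / v18 — and for its twin C2 `ManinOddAtFour` stmt-…-22967, input `h66₂` of
# TURNKEY-an-15 `not_two_dvd_maninConstant_of_noRationalTwoTorsion`)

WHAT IS PROVED (sorry-free, axioms standard).  Write E-an-135 `TowerUnitTwist p` for the cell's q-TOWER
UNIT-TWIST LAW (an g29, a `Prop` not yet in the tree — consumed here BY VALUE, signature VERBATIM from
Sketch-an-g29 §1–§2): for the newform `f` of `W` with plus index prime to `p` and every odd prime
`q ≠ p`, `q ∤ N`, `p ∤ (q-1)/2`, the conductor tower `qⁿ` carries, at arbitrarily high level, an EVEN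
PRIMITIVE character `χ` whose Euler-symmetrised twisted symbol sum is `r·Ω⁺(f)` with `s·r/p` non-integral
for all `s ⊥ p` (the `r`-clause of the tree's `ThreeAdicPolarWitness` / `TwoAdicPolarWitness`, `ρ = 1`).

* `threeAdicWitnessOfPlusIndexPrimeToThree_of_towerUnitTwist` — **E-an-136₃**: modularity
  (`exists_isNewformOf`, the crux's own fourth binder) ∧ LEMMA W ∧ `TowerUnitTwist 3` ⟹ E-es-66
  `…KatoCurve.ThreeAdicWitnessOfPlusIndexPrimeToThree` BY NAME.
* `twoAdicWitnessOfPlusIndexOdd_of_towerUnitTwist` — **E-an-136₂**: the `p = 2` twin ⟹ E-es-66₂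
  `…KatoCurve.TwoAdicWitnessOfPlusIndexOdd` BY NAME.
* `threeAdicWitnessOfPlusIndexPrimeToThree_of_towerUnitTwist'`, `twoAdicWitnessOfPlusIndexOdd_of_towerUnitTwist'`
  — the same with LEMMA W DISCHARGED by the tree theorem `wieferichLevel`
  (`Theorems/ManinLocalTwoThreeWieferichLevel.lean`): **E-es-66 ⟸ hnf ∧ E-an-135(3)**,
  **E-es-66₂ ⟸ hnf ∧ E-an-135(2)**.

PROOF (MEMO-an §71.4).  Dirichlet (Mathlib `Nat.forall_exists_prime_gt_and_modEq`) gives a prime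
`q ≡ 2 (mod 3)` [resp. `q ≡ 3 (mod 4)`] with `q > N`; put `n₁ := v_q(9^{q-1} - 1) + 1` [resp. with `8`];
the law gives `n ≥ n₁` and `χ` primitive even of conductor `qⁿ` with its unit `r`; LEMMA W at `x = 9`
[`x = 8`] gives `χ(9) ≠ 1`, so `χ(3) ∉ {±1}` [`χ(8) ≠ 1`]; `χ ≠ 1` (conductor `qⁿ > 1`);
`ord χ ∣ φ(qⁿ) = q^{n-1}(q-1)` is prime to `3` [at `p = 2`: `χ` even and `(ℤ/qⁿ)ˣ` cyclic give
`χ^{φ(qⁿ)/2} = 1` with `φ(qⁿ)/2` odd]; `qⁿ ⊥ pN`; `ρ := 1`; additivity of `W` at `p` from `p² ∣ N` through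
Carayol's `N = N_W` under modularity (`IsNewformOf.level_eq_conductorNorm_of_exists_isNewformOf` +
`ManinAdditive.not_good_and_not_mult_of_sq_dvd_conductorNorm`).
NOTE on the typed edge: Sketch-an-g29's `TowerReductionAtThree := WieferichLevel → TowerUnitTwist 3 → E-es-66`
carries no modularity binder; the tree reaches «`W` additive at `3`» from «`9 ∣ N`» only through
`exists_isNewformOf` (as every consumer of `h66` already binds it), so the edge is landed with `hnf`.

HONEST FRAMING: bookkeeping over the tree; E-an-135 is a LAW (Ash–Stevens shape, not in the held
literature), taken as a hypothesis by value.  BSD is not proved by this file; Manin's conjecture is not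
proved by this file; C2/C3 remain OPEN.
-/

set_option autoImplicit false
set_option linter.dupNamespace false

noncomputable section

open scoped Classical MatrixGroups ModularForm ComplexConjugate

open CongruenceSubgroup Complex WeierstrassCurve Literature.NumberTheory.EllipticCurves
  Literature.NumberTheory.EllipticCurves.ModularForms
  Summit.BirchSwinnertonDyer.Rank1Residual.ManinAdditive.KatoCurve

namespace Summit.BirchSwinnertonDyer.BirchSwinnertonDyer.Theorems.ManinLocalTwoThree

/-! ### Small arithmetic helpers on Dirichlet characters of prime-power conductor -/

/-- The order of a Dirichlet character mod `m` divides `φ(m)` (Euler). -/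
theorem orderOf_dirichletCharacter_dvd_totient {m : ℕ} (χ : DirichletCharacter ℂ m) :
    orderOf χ ∣ Nat.totient m := by
  apply orderOf_dvd_of_pow_eq_one
  apply MulChar.ext
  intro a
  rw [MulChar.pow_apply_coe, MulChar.one_apply_coe, ← map_pow, ← Units.val_pow_eq_pow_val,
    ZMod.pow_totient, Units.val_one, map_one]

/-- For an odd prime power modulus `qⁿ` (`n ≥ 1`), an EVEN Dirichlet character satisfies
`χ ^ (q^{n-1}·((q-1)/2)) = 1`: every unit `a` has `a^{φ/2} = ±1` because `(ℤ/qⁿ)ˣ` is cyclic. -/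
theorem pow_half_totient_eq_one_of_even {q n : ℕ} (hq : q.Prime) (hq2 : q ≠ 2) (hn : 1 ≤ n)
    {χ : DirichletCharacter ℂ (q ^ n)} (hχ : χ.Even) :
    χ ^ (q ^ (n - 1) * ((q - 1) / 2)) = 1 := by
  haveI : Fact q.Prime := ⟨hq⟩
  haveI : NeZero (q ^ n) := ⟨pow_ne_zero _ hq.ne_zero⟩
  haveI : IsCyclic (ZMod (q ^ n))ˣ := ZMod.isCyclic_units_of_prime_pow q hq hq2 n
  have hq3 : 3 ≤ q := by
    rcases hq.eq_two_or_odd' with h | h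
    · exact absurd h hq2
    · have := hq.two_le; rcases h with ⟨k, hk⟩; omega
  have hqodd : q % 2 = 1 := hq.eq_two_or_odd.resolve_left hq2
  -- `-1` has order `2` in `(ℤ/qⁿ)ˣ`
  have hneg : orderOf (-1 : (ZMod (q ^ n))ˣ) = 2 := by
    haveI : Fact (Nat.Prime 2) := ⟨Nat.prime_two⟩
    refine orderOf_eq_prime (by rw [neg_one_sq]) ?_
    intro h
    have h' : ((-1 : (ZMod (q ^ n))ˣ) : ZMod (q ^ n)) = 1 := by rw [h, Units.val_one]
    rw [Units.val_neg, Units.val_one] at h'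
    have hlt : 2 < q ^ n := lt_of_lt_of_le (by omega) (Nat.le_self_pow (by omega) q |>.trans
      (Nat.pow_le_pow_right hq.pos hn))
    haveI : Fact (2 < q ^ n) := ⟨hlt⟩
    exact ZMod.neg_one_ne_one h'
  apply MulChar.ext
  intro a
  set M : ℕ := q ^ (n - 1) * ((q - 1) / 2) with hM
  have h2M : 2 * M = Nat.totient (q ^ n) := by
    rw [Nat.totient_prime_pow hq hn, hM]
    have : (q - 1) / 2 * 2 = q - 1 := Nat.div_mul_cancel (by omega)
    calc 2 * (q ^ (n - 1) * ((q - 1) / 2)) = q ^ (n - 1) * ((q - 1) / 2 * 2) := by ring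
      _ = q ^ (n - 1) * (q - 1) := by rw [this]
  have haM : (a ^ M) ^ 2 = 1 := by
    rw [← pow_mul, mul_comm, h2M, ZMod.pow_totient]
  obtain ⟨i, -, hi⟩ := exists_pow_eq_of_pow_eq_one_of_orderOf_eq (by norm_num) hneg haM
  rw [MulChar.pow_apply_coe, MulChar.one_apply_coe, ← map_pow, ← Units.val_pow_eq_pow_val, ← hi,
    Units.val_pow_eq_pow_val, Units.val_neg, Units.val_one, map_pow, hχ, one_pow]

/-! ### E-an-136₃ : the tower law at `3` gives E-es-66 -/

/-- **E-an-136₃ (cell bsd-f2-manin, MEMO-an §71.4): modularity ∧ LEMMA W ∧ E-an-135 `TowerUnitTwist 3`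
⟹ E-es-66 `ThreeAdicWitnessOfPlusIndexPrimeToThree` BY NAME.**  The hypotheses `hW` and `h135` are the
`Prop`s `BsdF2ManinAnG29.WieferichLevel` and `BsdF2ManinAnG29.TowerUnitTwist 3` of
HOME/an/g29/Sketch-an-g29.lean written out by value (their `def`s are not in the tree); `hnf` is the
Modularity Theorem `exists_isNewformOf` (Diamond–Shurman Thm. 8.8.3), needed only to read «`W` additive at
`3`» off «`9 ∣ N`» (Carayol).  [cite: DiamondShurman2005, Thm. 8.8.1] -/
theorem threeAdicWitnessOfPlusIndexPrimeToThree_of_towerUnitTwist (hnf : exists_isNewformOf)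
    (hW : ∀ (q x n : ℕ), q.Prime → q ≠ 2 → 1 < x → ¬ q ∣ x → padicValNat q (x ^ (q - 1) - 1) < n →
      ∀ χ : DirichletCharacter ℂ (q ^ n), χ.IsPrimitive → χ (x : ZMod (q ^ n)) ≠ 1)
    (h135 : ∀ (W : WeierstrassCurve ℚ) [W.IsElliptic] {N : ℕ} [NeZero N] (f : CuspForm (Gamma0 N) 2),
      IsNewformOf W f → PlusIndexPrimeTo 3 f →
      ∀ (q : ℕ) [Fact q.Prime], q ≠ 2 → q ≠ 3 → ¬ q ∣ N → ¬ 3 ∣ (q - 1) / 2 →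
      ∀ n₁ : ℕ, ∃ n : ℕ, n₁ ≤ n ∧
        ∃ χ : DirichletCharacter ℂ (q ^ n), χ.IsPrimitive ∧ χ.Even ∧
          ∃ r : ℂ,
            (∏ ℓ ∈ N.primeFactors with ¬ ℓ ^ 2 ∣ N,
                (((ℓ : ℂ) - (W.LFunction ℓ : ℂ) * χ (ℓ : ZMod (q ^ n))) *
                  ((ℓ : ℂ) - (W.LFunction ℓ : ℂ) * (χ (ℓ : ZMod (q ^ n)))⁻¹))) *
                twistedSymbolSum f χ = r * (plusPeriod f : ℂ) ∧
            ∀ s : ℕ, ¬ 3 ∣ s → ¬ _root_.IsIntegral ℤ ((s : ℂ) * r / (3 : ℕ))) :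
    ThreeAdicWitnessOfPlusIndexPrimeToThree := by
  intro W _ _ N _ D hopt h9 hplus
  -- an auxiliary prime `q ≡ 2 (mod 3)`, `q > N`
  obtain ⟨q, hqN, hq, hqmod⟩ :=
    Nat.forall_exists_prime_gt_and_modEq N (q := 3) (a := 2) (by norm_num) (by norm_num)
  haveI : Fact q.Prime := ⟨hq⟩
  have hqmod' : q % 3 = 2 := hqmod
  have hN9 : 9 ≤ N := Nat.le_of_dvd (Nat.pos_of_ne_zero (NeZero.ne N)) (by simpa using h9)
  have hq2 : q ≠ 2 := by omega
  have hq3 : q ≠ 3 := by omega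
  have hqodd : q % 2 = 1 := hq.eq_two_or_odd.resolve_left hq2
  have hqN' : ¬ q ∣ N := fun h => absurd (Nat.le_of_dvd (by omega) h) (by omega)
  have hq31 : ¬ 3 ∣ (q - 1) / 2 := by omega
  -- the law at level `n₁ = v_q(9^{q-1} - 1) + 1`
  obtain ⟨n, hn, χ, hprim, heven, r, hr, hunit⟩ :=
    h135 W D.f D.isNewformOf hplus q hq2 hq3 hqN' hq31 (padicValNat q (9 ^ (q - 1) - 1) + 1)
  haveI : NeZero (q ^ n) := ⟨pow_ne_zero _ hq.ne_zero⟩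
  have hn1 : 1 ≤ n := le_trans (Nat.le_add_left 1 _) hn
  -- LEMMA W at `x = 9`: `χ(9) ≠ 1`, hence `χ(3) ∉ {±1}`
  have hq9 : ¬ q ∣ 9 := fun h =>
    hq3 ((Nat.prime_dvd_prime_iff_eq hq Nat.prime_three).mp (hq.dvd_of_dvd_pow (show q ∣ 3 ^ 2 from h)))
  have h9χ : χ ((9 : ℕ) : ZMod (q ^ n)) ≠ 1 :=
    hW q 9 n hq hq2 (by norm_num) hq9 (Nat.lt_of_succ_le hn) χ hprim
  have hχ3sq : χ (3 : ZMod (q ^ n)) ^ 2 ≠ 1 := by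
    rw [← map_pow]
    convert h9χ using 2
    push_cast
    norm_num
  have hχ3 : χ (3 : ZMod (q ^ n)) ≠ 1 := fun h => hχ3sq (by rw [h, one_pow])
  have hχ3' : χ (3 : ZMod (q ^ n)) ≠ -1 := fun h => hχ3sq (by rw [h, neg_one_sq])
  -- `χ ≠ 1`
  have hχne : χ ≠ 1 := by
    rintro rfl
    rw [DirichletCharacter.isPrimitive_def, DirichletCharacter.conductor_one] at hprim
    have : 1 < q ^ n := Nat.one_lt_pow (by omega) hq.one_lt
    omega
  -- `3 ∤ ord χ ∣ q^{n-1}(q-1)`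
  have hordχ : orderOf χ ∣ q ^ (n - 1) * (q - 1) := by
    have h := orderOf_dirichletCharacter_dvd_totient χ
    rwa [Nat.totient_prime_pow hq hn1] at h
  have h3ord : ¬ 3 ∣ orderOf χ := by
    intro h3
    rcases (Nat.Prime.dvd_mul Nat.prime_three).mp (h3.trans hordχ) with h | h
    · exact hq3 ((Nat.prime_dvd_prime_iff_eq Nat.prime_three hq).mp
        (Nat.prime_three.dvd_of_dvd_pow h)).symm
    · omega
  -- `qⁿ ⊥ 3N`
  have hcop : (q ^ n).Coprime (3 * N) := by
    apply Nat.Coprime.pow_left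
    rw [Nat.coprime_mul_iff_right]
    exact ⟨(Nat.coprime_primes hq Nat.prime_three).mpr hq3, (hq.coprime_iff_not_dvd).mpr hqN'⟩
  -- `W` is additive at `3` (Carayol under modularity)
  have hadd : ¬ W.HasGoodReductionAtPrime 3 ∧ ¬ W.HasMultiplicativeReductionAtPrime 3 :=
    haveI : Fact (Nat.Prime 3) := ⟨Nat.prime_three⟩
    Summit.BirchSwinnertonDyer.Rank1Residual.ManinAdditive.not_good_and_not_mult_of_sq_dvd_conductorNorm W
      ((IsNewformOf.level_eq_conductorNorm_of_exists_isNewformOf hnf D.isNewformOf) ▸ h9)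
  refine ⟨q ^ n, inferInstance, χ, r, 1, D.isNewformOf, hadd.1, hadd.2, hcop, hprim, hχne, h3ord,
    hχ3, hχ3', heven, by simp, hr, fun s hs => ?_⟩
  simpa using hunit s hs

/-- **E-es-66 ⟸ modularity ∧ E-an-135(3)** — E-an-136₃ with LEMMA W discharged by the tree theorem
`wieferichLevel`. [cite: DiamondShurman2005, Thm. 8.8.1] -/
theorem threeAdicWitnessOfPlusIndexPrimeToThree_of_towerUnitTwist' (hnf : exists_isNewformOf)
    (h135 : ∀ (W : WeierstrassCurve ℚ) [W.IsElliptic] {N : ℕ} [NeZero N] (f : CuspForm (Gamma0 N) 2),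
      IsNewformOf W f → PlusIndexPrimeTo 3 f →
      ∀ (q : ℕ) [Fact q.Prime], q ≠ 2 → q ≠ 3 → ¬ q ∣ N → ¬ 3 ∣ (q - 1) / 2 →
      ∀ n₁ : ℕ, ∃ n : ℕ, n₁ ≤ n ∧
        ∃ χ : DirichletCharacter ℂ (q ^ n), χ.IsPrimitive ∧ χ.Even ∧
          ∃ r : ℂ,
            (∏ ℓ ∈ N.primeFactors with ¬ ℓ ^ 2 ∣ N,
                (((ℓ : ℂ) - (W.LFunction ℓ : ℂ) * χ (ℓ : ZMod (q ^ n))) *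
                  ((ℓ : ℂ) - (W.LFunction ℓ : ℂ) * (χ (ℓ : ZMod (q ^ n)))⁻¹))) *
                twistedSymbolSum f χ = r * (plusPeriod f : ℂ) ∧
            ∀ s : ℕ, ¬ 3 ∣ s → ¬ _root_.IsIntegral ℤ ((s : ℂ) * r / (3 : ℕ))) :
    ThreeAdicWitnessOfPlusIndexPrimeToThree :=
  threeAdicWitnessOfPlusIndexPrimeToThree_of_towerUnitTwist hnf wieferichLevel h135

/-! ### E-an-136₂ : the tower law at `2` gives E-es-66₂ -/

/-- **E-an-136₂ (cell bsd-f2-manin, MEMO-an §71.4): modularity ∧ LEMMA W ∧ E-an-135 `TowerUnitTwist 2`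
⟹ E-es-66₂ `TwoAdicWitnessOfPlusIndexOdd` BY NAME** (`q ≡ 3 (mod 4)`, LEMMA W at `x = 8`; the odd order of
`χ` from evenness and cyclicity of `(ℤ/qⁿ)ˣ`).  [cite: DiamondShurman2005, Thm. 8.8.1] -/
theorem twoAdicWitnessOfPlusIndexOdd_of_towerUnitTwist (hnf : exists_isNewformOf)
    (hW : ∀ (q x n : ℕ), q.Prime → q ≠ 2 → 1 < x → ¬ q ∣ x → padicValNat q (x ^ (q - 1) - 1) < n →
      ∀ χ : DirichletCharacter ℂ (q ^ n), χ.IsPrimitive → χ (x : ZMod (q ^ n)) ≠ 1)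
    (h135 : ∀ (W : WeierstrassCurve ℚ) [W.IsElliptic] {N : ℕ} [NeZero N] (f : CuspForm (Gamma0 N) 2),
      IsNewformOf W f → PlusIndexPrimeTo 2 f →
      ∀ (q : ℕ) [Fact q.Prime], q ≠ 2 → q ≠ 2 → ¬ q ∣ N → ¬ 2 ∣ (q - 1) / 2 →
      ∀ n₁ : ℕ, ∃ n : ℕ, n₁ ≤ n ∧
        ∃ χ : DirichletCharacter ℂ (q ^ n), χ.IsPrimitive ∧ χ.Even ∧
          ∃ r : ℂ,
            (∏ ℓ ∈ N.primeFactors with ¬ ℓ ^ 2 ∣ N,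
                (((ℓ : ℂ) - (W.LFunction ℓ : ℂ) * χ (ℓ : ZMod (q ^ n))) *
                  ((ℓ : ℂ) - (W.LFunction ℓ : ℂ) * (χ (ℓ : ZMod (q ^ n)))⁻¹))) *
                twistedSymbolSum f χ = r * (plusPeriod f : ℂ) ∧
            ∀ s : ℕ, ¬ 2 ∣ s → ¬ _root_.IsIntegral ℤ ((s : ℂ) * r / (2 : ℕ))) :
    TwoAdicWitnessOfPlusIndexOdd := by
  intro W _ _ N _ D hopt h4 hplus
  -- an auxiliary prime `q ≡ 3 (mod 4)`, `q > N`
  obtain ⟨q, hqN, hq, hqmod⟩ :=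
    Nat.forall_exists_prime_gt_and_modEq N (q := 4) (a := 3) (by norm_num) (by norm_num)
  haveI : Fact q.Prime := ⟨hq⟩
  have hqmod' : q % 4 = 3 := hqmod
  have hN4 : 4 ≤ N := Nat.le_of_dvd (Nat.pos_of_ne_zero (NeZero.ne N)) (by simpa using h4)
  have hq2 : q ≠ 2 := by omega
  have hqN' : ¬ q ∣ N := fun h => absurd (Nat.le_of_dvd (by omega) h) (by omega)
  have hq21 : ¬ 2 ∣ (q - 1) / 2 := by omega
  obtain ⟨n, hn, χ, hprim, heven, r, hr, hunit⟩ :=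
    h135 W D.f D.isNewformOf hplus q hq2 hq2 hqN' hq21 (padicValNat q (8 ^ (q - 1) - 1) + 1)
  haveI : NeZero (q ^ n) := ⟨pow_ne_zero _ hq.ne_zero⟩
  have hn1 : 1 ≤ n := le_trans (Nat.le_add_left 1 _) hn
  -- LEMMA W at `x = 8`: `χ(8) ≠ 1`
  have hq8 : ¬ q ∣ 8 := fun h =>
    hq2 ((Nat.prime_dvd_prime_iff_eq hq Nat.prime_two).mp (hq.dvd_of_dvd_pow (show q ∣ 2 ^ 3 from h)))
  have h8χ : χ ((8 : ℕ) : ZMod (q ^ n)) ≠ 1 :=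
    hW q 8 n hq hq2 (by norm_num) hq8 (Nat.lt_of_succ_le hn) χ hprim
  have hχ8 : χ (8 : ZMod (q ^ n)) ≠ 1 := by
    convert h8χ using 2
    push_cast
    rfl
  -- `χ ≠ 1`
  have hχne : χ ≠ 1 := by
    rintro rfl
    rw [DirichletCharacter.isPrimitive_def, DirichletCharacter.conductor_one] at hprim
    have : 1 < q ^ n := Nat.one_lt_pow (by omega) hq.one_lt
    omega
  -- `ord χ` is odd: it divides the odd number `q^{n-1}·(q-1)/2`
  have h2ord : ¬ 2 ∣ orderOf χ := by
    intro h2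
    have hM := orderOf_dvd_of_pow_eq_one (pow_half_totient_eq_one_of_even hq hq2 hn1 heven)
    have h2M : 2 ∣ q ^ (n - 1) * ((q - 1) / 2) := h2.trans hM
    rcases (Nat.Prime.dvd_mul Nat.prime_two).mp h2M with h | h
    · exact hq2 ((Nat.prime_dvd_prime_iff_eq Nat.prime_two hq).mp (Nat.prime_two.dvd_of_dvd_pow h)).symm
    · omega
  -- `qⁿ ⊥ 2N`
  have hcop : (q ^ n).Coprime (2 * N) := by
    apply Nat.Coprime.pow_left
    rw [Nat.coprime_mul_iff_right]
    exact ⟨(Nat.coprime_primes hq Nat.prime_two).mpr hq2, (hq.coprime_iff_not_dvd).mpr hqN'⟩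
  -- `W` is additive at `2` (Carayol under modularity)
  have hadd : ¬ W.HasGoodReductionAtPrime 2 ∧ ¬ W.HasMultiplicativeReductionAtPrime 2 :=
    haveI : Fact (Nat.Prime 2) := ⟨Nat.prime_two⟩
    Summit.BirchSwinnertonDyer.Rank1Residual.ManinAdditive.not_good_and_not_mult_of_sq_dvd_conductorNorm W
      ((IsNewformOf.level_eq_conductorNorm_of_exists_isNewformOf hnf D.isNewformOf) ▸ h4)
  refine ⟨q ^ n, inferInstance, χ, r, 1, D.isNewformOf, hadd.1, hadd.2, hcop, hprim, hχne, h2ord,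
    hχ8, by simp, hr, fun s hs => ?_⟩
  simpa using hunit s hs

/-- **E-es-66₂ ⟸ modularity ∧ E-an-135(2)** — E-an-136₂ with LEMMA W discharged by the tree theorem
`wieferichLevel`. [cite: DiamondShurman2005, Thm. 8.8.1] -/
theorem twoAdicWitnessOfPlusIndexOdd_of_towerUnitTwist' (hnf : exists_isNewformOf)
    (h135 : ∀ (W : WeierstrassCurve ℚ) [W.IsElliptic] {N : ℕ} [NeZero N] (f : CuspForm (Gamma0 N) 2),
      IsNewformOf W f → PlusIndexPrimeTo 2 f →
      ∀ (q : ℕ) [Fact q.Prime], q ≠ 2 → q ≠ 2 → ¬ q ∣ N → ¬ 2 ∣ (q - 1) / 2 →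
      ∀ n₁ : ℕ, ∃ n : ℕ, n₁ ≤ n ∧
        ∃ χ : DirichletCharacter ℂ (q ^ n), χ.IsPrimitive ∧ χ.Even ∧
          ∃ r : ℂ,
            (∏ ℓ ∈ N.primeFactors with ¬ ℓ ^ 2 ∣ N,
                (((ℓ : ℂ) - (W.LFunction ℓ : ℂ) * χ (ℓ : ZMod (q ^ n))) *
                  ((ℓ : ℂ) - (W.LFunction ℓ : ℂ) * (χ (ℓ : ZMod (q ^ n)))⁻¹))) *
                twistedSymbolSum f χ = r * (plusPeriod f : ℂ) ∧
            ∀ s : ℕ, ¬ 2 ∣ s → ¬ _root_.IsIntegral ℤ ((s : ℂ) * r / (2 : ℕ))) :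
    TwoAdicWitnessOfPlusIndexOdd :=
  twoAdicWitnessOfPlusIndexOdd_of_towerUnitTwist hnf wieferichLevel h135

end Summit.BirchSwinnertonDyer.BirchSwinnertonDyer.Theorems.ManinLocalTwoThree

end
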